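import Summits.HubbardSuperconductivity.HubbardSuperconductivity.Theses.ChiralWindow
import Literature.MathematicalPhysics.QuantumLattice.DWaveOrderParameterProofs
import Summits.HubbardSuperconductivity.HubbardSuperconductivity.Theorems.ChiralWindowCwGlue
import Summits.HubbardSuperconductivity.HubbardSuperconductivity.Theorems.ChiralWindowAssembly
import Summits.HubbardSuperconductivity.HubbardSuperconductivity.Theorems.ChiralWindowCwChiralConstructionSplit

/-!
# Crux `CwChiralConstruction` (stmt-HubbardSuperconductivity-1740) — redirect strategist r1: the split pieces, typed

Seat planner-cstrat-stmt-HubbardSuperconductivity-1740-r1-0 (crux-strategist REDIRECT r1), 2026-08-17.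
The two children of the route-level split `CwChiralConstruction ⟸ (Kpt) ∧ (M)` with their route decl names
(statements VERBATIM = the registered stubs `stub_klLeadingAtWindowDoping` / `stub_dWaveOrderFloorOnLeadingWindows`
of `Lines/ladder_scale_transfer.lean` rev c7-2, also registered on the sibling crux stmt-2010), and the two stubs of
(M)'s birth skeleton (the stair split (UP)/(IR) of census gen 1 §D6). Everything is a `def … : Prop`; nothing is asserted.
-/

noncomputable section

namespace Summit.HubbardSuperconductivity.HubbardSuperconductivity.Cruxes.CwChiralConstruction.StrategistR1

open Literature.MathematicalPhysics.QuantumLattice Filter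
open scoped Topology

/-- (Kpt) child 1, kind support: `B₁g` strictly leading, margin `γU²`, at ONE window doping `δ₀ ∈ [3/10,12/25]`,
for all `U < U₁` (the whole Kohn–Luttinger INPUT of the crux; certified numerics). -/
def CwKLLeadingAtWindowDoping : Prop :=
  ∃ δ₀ ∈ Set.Icc (3/10 : ℝ) (12/25), ∃ γ U₁ : ℝ, 0 < γ ∧ 0 < U₁ ∧ ∀ U ∈ Set.Ioo (0:ℝ) U₁, ∀ χ : Literature.MathematicalPhysics.QuantumLattice.D4Irrep, χ ≠ Literature.MathematicalPhysics.QuantumLattice.D4Irrep.B1g → Literature.MathematicalPhysics.QuantumLattice.channelInf (Literature.MathematicalPhysics.QuantumLattice.squareDispersion 1 0) (Literature.MathematicalPhysics.QuantumLattice.chemicalPotentialOfDensity (Literature.MathematicalPhysics.QuantumLattice.squareDispersion 1 0) (1 - δ₀)) U Literature.MathematicalPhysics.QuantumLattice.D4Irrep.B1g + γ * U ^ 2 ≤ Literature.MathematicalPhysics.QuantumLattice.channelInf (Literature.MathematicalPhysics.QuantumLattice.squareDispersion 1 0) (Literature.MathematicalPhysics.QuantumLattice.chemicalPotentialOfDensity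 (Literature.MathematicalPhysics.QuantumLattice.squareDispersion 1 0) (1 - δ₀)) U χ

/-- (M) child 2, kind crux: the Kohn–Luttinger MECHANISM in local uniform form — on every level window
`[μ₁,μ₂] ⊂ [-2,-3/10]` where `B₁g` leads by `γU²` for `U < U₁`, a floor `e^{-C/U²} ≤ dWaveOrderParameter U μ` on all
operator levels `μ ∈ [μ₁+U/2, μ₂]`, `U < U₀`. -/
def CwDWaveOrderFloorOnLeadingWindows : Prop :=
  ∀ μ₁ μ₂ γ U₁ : ℝ, -2 ≤ μ₁ → μ₁ < μ₂ → μ₂ ≤ -(3:ℝ) / 10 → 0 < γ → 0 < U₁ → (∀ U ∈ Set.Ioo (0:ℝ) U₁, ∀ μ ∈ Set.Icc μ₁ μ₂, ∀ χ : Literature.MathematicalPhysics.QuantumLattice.D4Irrep, χ ≠ Literature.MathematicalPhysics.QuantumLattice.D4Irrep.B1g → Literature.MathematicalPhysics.QuantumLattice.channelInf (Literature.MathematicalPhysics.QuantumLattice.squareDispersion 1 0) μ U Literature.MathematicalPhysics.QuantumLattice.D4Irrep.B1g + γ * U ^ 2 ≤ Literature.MathematicalPhysics.QuantumLattice.channelInf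 (Literature.MathematicalPhysics.QuantumLattice.squareDispersion 1 0) μ U χ) → ∃ U₀ C : ℝ, 0 < U₀ ∧ 0 < C ∧ ∀ U ∈ Set.Ioo (0:ℝ) U₀, ∀ μ ∈ Set.Icc (μ₁ + U / 2) μ₂, Real.exp (-C / U ^ 2) ≤ Literature.MathematicalPhysics.QuantumLattice.dWaveOrderParameter U μ

/-! ## (M)'s own two-piece structure: the stair split (UP)/(IR) — stubs of (M)'s birth skeleton -/

/-- The Kohn–Luttinger leading hypothesis on a level window. -/
def KLLeadingOn (μ₁ μ₂ γ U₁ : ℝ) : Prop :=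
  ∀ U ∈ Set.Ioo (0:ℝ) U₁, ∀ μ ∈ Set.Icc μ₁ μ₂, ∀ χ : D4Irrep, χ ≠ D4Irrep.B1g →
    channelInf (squareDispersion 1 0) μ U D4Irrep.B1g + γ * U ^ 2 ≤ channelInf (squareDispersion 1 0) μ U χ

/-- The stair `F(U,μ,h) = liminf_L m_{L+1}(h)` of the Koma–Tasaki staircase. -/
def stair (U μ h : ℝ) : ℝ :=
  liminf (fun L : ℕ => dWaveSourceDensity (L + 1) U μ h) atTop

/-- The `U`-dependent stair height `h₁(U) = exp(-C₁/U²)`. -/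
def stairHeight (C₁ U : ℝ) : ℝ := Real.exp (-C₁ / U ^ 2)

/-- (UP) fixed-source floor: on every KL-leading level window and for every stair exponent `C₁ > 0`, a floor
`exp(-C/U²) ≤ F(U, μ, exp(-C₁/U²))` on the single stair `h₁(U)`, all small `U`, all operator levels (massive phase: the
source is ON, no Goldstone mode). -/
def CwStairFloorOnLeadingWindows : Prop :=
  ∀ μ₁ μ₂ γ U₁ : ℝ, -2 ≤ μ₁ → μ₁ < μ₂ → μ₂ ≤ -(3:ℝ) / 10 → 0 < γ → 0 < U₁ → KLLeadingOn μ₁ μ₂ γ U₁ →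
    ∀ C₁ : ℝ, 0 < C₁ → ∃ U₀ C : ℝ, 0 < U₀ ∧ 0 < C ∧ ∀ U ∈ Set.Ioo (0:ℝ) U₀, ∀ μ ∈ Set.Icc (μ₁ + U / 2) μ₂,
      Real.exp (-C / U ^ 2) ≤ stair U μ (stairHeight C₁ U)

/-- (IR) source-removal stability (the Goldstone half): a stair exponent `C₁ > 0` and a `U`-UNIFORM ratio `θ > 0` with
`θ · F(U, μ, exp(-C₁/U²)) ≤ F(U, μ, h)` for every `h ∈ (0, exp(-C₁/U²))`, all small `U`, all operator levels. -/
def CwSourceRemovalStabilityOnLeadingWindows : Prop :=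
  ∀ μ₁ μ₂ γ U₁ : ℝ, -2 ≤ μ₁ → μ₁ < μ₂ → μ₂ ≤ -(3:ℝ) / 10 → 0 < γ → 0 < U₁ → KLLeadingOn μ₁ μ₂ γ U₁ →
    ∃ C₁ θ U₀ : ℝ, 0 < C₁ ∧ 0 < θ ∧ 0 < U₀ ∧ ∀ U ∈ Set.Ioo (0:ℝ) U₀, ∀ μ ∈ Set.Icc (μ₁ + U / 2) μ₂,
      ∀ h ∈ Set.Ioo (0:ℝ) (stairHeight C₁ U), θ * stair U μ (stairHeight C₁ U) ≤ stair U μ h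


/-! ## Typed census statements (r1): the perturbative rung (S8) and the two-sided placement facts -/

/-- (S8 / UPpert) **Sourced perturbative stability** — the RIGID (analytic-in-`U`) form of the TOP of the staircase: for every
level window and every fixed source `h ∈ (0, h₀)` there is `U₀(h) > 0` such that for `0 ≤ U < U₀(h)` the interacting stair stays
within a relative `K·U·|log h|` of the free one. Plausibly provable (BGM2006 multiscale above scale `h`, where the source cuts the
Cooper channel off, + GM2010 nodal Dirac analysis below it; small parameter `U log(W/h)`, no sign resolution) — but `U₀(h) ≍ c/|log h|`,
i.e. it lives on stairs `h ≥ e^{-c/U}`, exponentially above `h₁(U) = e^{-C₁/U²}`; by monotonicity of the staircase it implies nothing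
below (census r1 §Strengthen S8: frontier rung / BC9 ceiling marker, not a line). -/
def SourcedPerturbativeStability : Prop :=
  ∀ μ₁ μ₂ : ℝ, -2 ≤ μ₁ → μ₁ < μ₂ → μ₂ ≤ -(3:ℝ) / 10 → ∀ h₀ : ℝ, 0 < h₀ → h₀ < 1 →
    ∃ K : ℝ, 0 < K ∧ ∀ h ∈ Set.Ioo (0:ℝ) h₀, ∃ U₀ : ℝ, 0 < U₀ ∧ ∀ U ∈ Set.Ico (0:ℝ) U₀, ∀ μ ∈ Set.Icc μ₁ μ₂,
      |stair U μ h - stair 0 μ h| ≤ K * U * |Real.log h| * stair 0 μ h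

/-- PLACEMENT (for the tribunal): the crux is logically INCOMPARABLE with the summit (probes: `C → S` and `S → C` both fail,
`#h21_crux_probe` CLEAN); what the tree proves is exactly the TWO-hypothesis packet
`CwChiralConstruction → CwSsbToEvenTorusLRO → HubbardSuperconductivity` (landed `cwGlue_proof` + `cwAssembly_proof`), whose
second hypothesis (SSB under an infinitesimal source ⇒ LRO of EVERY sector ground state, stmt-10439) is itself open. -/
theorem summit_of_crux_of_transfer
    (hC : Summit.HubbardSuperconductivity.HubbardSuperconductivity.Theses.ChiralWindow.CwChiralConstruction)
    (hT : Summit.HubbardSuperconductivity.HubbardSuperconductivity.Theses.ChiralWindow.CwSsbToEvenTorusLRO) :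
    HubbardSuperconductivity :=
  Summit.HubbardSuperconductivity.HubbardSuperconductivity.Theorems.cwAssembly_proof
    (Summit.HubbardSuperconductivity.HubbardSuperconductivity.Theorems.cwGlue_proof hC hT)

/-- PLACEMENT of the split: the two children and the open transfer give the summit (landed split glue p167311 + the packet above). -/
theorem summit_of_Kpt_of_M_of_transfer (hKpt : CwKLLeadingAtWindowDoping) (hM : CwDWaveOrderFloorOnLeadingWindows)
    (hT : Summit.HubbardSuperconductivity.HubbardSuperconductivity.Theses.ChiralWindow.CwSsbToEvenTorusLRO) :
    HubbardSuperconductivity :=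
  summit_of_crux_of_transfer
    (Summit.HubbardSuperconductivity.HubbardSuperconductivity.Theorems.CwChiralConstruction_of_subs hKpt hM) hT

end Summit.HubbardSuperconductivity.HubbardSuperconductivity.Cruxes.CwChiralConstruction.StrategistR1

end
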